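import Literature.MathematicalPhysics.QuantumFieldTheory.Balaban1983to89.T4ReflectionConeSharp
import Literature.MathematicalPhysics.QuantumFieldTheory.Balaban1983to89.T3DescentFibreTower
import Summits.QuantumFields.YangMills.Theorems.UnitScaleTiltProp8FlatCubeSequence
import HarnessLib

/-!
# Route `UnitScaleTilt`, crux K1 child «MinimiserStabilityRegPr» (stmt-QuantumFields-19200), v8 junction **J0 «𝒞_cube(U) ⊆ fibre(V)»** (OWNER RULINGS g21-№5 §2, g22-№1 §C:
# «SETTLED YES-SHAPED ON THE ROUTE'S ACCOUNT; what remains is TYPING … ASK ★p1 g15: type `constraints_cubeSeq_sub_fibre` (the C2 descent, an induction on k − m over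
# `bondAvgIter`/`iterBlockOf`; S–M, def-free)») — **THE MULTI-LEVEL BOND-INDEXED CONSTRAINTS OF A NESTED FAMILY DETERMINE THE TOP AVERAGE**: for EVERY nested family
# `D : B6SectADomainsV1.Domains P` (no (2.2) separation, no M-alignment needed) and every family of TWO-BLOCK-LOCAL averaging maps (Bałaban's (0.4): `twoBlockLocal_blockAvg`),
# a configuration `U″` whose `j`-fold averages agree with those of `U` on every index bond `(j, b) ∈ 𝔅 = ⋃_j Λ_j` ([Balaban1984PropagatorsII] (2.3): «at least one end-point in
# Ω_j, none inside B(Ω_{j+1})»; level 0 included = «U″ = U off □₁») has THE SAME `k`-FOLD AVERAGE on ALL of `T^{(k)}` — print [Balaban1985Variational] p. 301 (150):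
# «this space is defined by more restrictive functional conditions»

Cell `ym3-torus` (HUMAN RULING D-0037, YM ladder rung R3), seat `ym3-torus-p1` gen 15.  `--supports stmt-QuantumFields-19200 --as helper`; count-neutral; def-free.

THE DESCENT (RULING g22-№1 §C2, typed here as an induction UPWARD in the level `m ≤ k` on bonds with NO deep end-point): at `m = 0` such a bond is a level-0 index bond (`Ω₀ = T`),
prescribed; at `m + 1`, either an end-point lies in `Ω_{m+1}` (⇒ index bond of `Λ_{m+1}`, prescribed) or both lie outside (⇒ by TWO-BLOCK LOCALITY `T4ReflectionConeSharp.TwoBlockLocal`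
the `(m+1)`-average at the bond reads only `m`-bonds with both end-points in its two blocks, which are then not deep at level `m` — recurse).  At `m = k` no site is deep
(`Ω_{k+1} = ∅`), so ALL `k`-bonds agree.

WHAT IS PROVED (sorry-free; axioms standard):
* **`iter_eq_of_constraints`** — `∀ m ≤ D.k`, every `m`-bond with no deep end-point: `iter av m U″ c = iter av m U c`, for `av` two-block local at every level;
* **`iter_top_eq_of_constraints`** — `Averaging.iter av D.k U″ = Averaging.iter av D.k U`;
* at the d = 3 carrier with Bałaban's (0.4) `blockAvg ℰ` (`k = K − n`): **`descendTo_eq_of_constraints`**, **`constraints_sub_fibre`** (`U ∈ fibre V ⇒ U″ ∈ fibre V`) for every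
  `D : Domains (F.P K)` with `D.k = K − n`, and the named instance **`constraints_cubeSeq_sub_fibre`** for `D := FlatCubeSequence.cubeSeqT3 F n K x₀ ρ S` (the M-aligned
  `FlatCubeSequenceAligned.cubeSeqMT3` is the same one-liner through `constraints_sub_fibre`; not restated here).
HONEST SCOPE.  Set-theoretic locality bookkeeping; the LOCATED DIFFERENCE with print's (148)–(150) (the top cube split `□′_k`/`□″_k`) is the single-top-level sub-case `□′_k = ∅`
(RULING g22-№1 §C3); NOT a claim about the mass gap.

References: [Balaban1985Variational] (148)–(150) p.301, (156) p.302; [Balaban1984PropagatorsII] (2.3)–(2.4), (2.6) p.224; [Balaban1987RG1] (0.4) p.253.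
-/

set_option autoImplicit false

namespace Summit.QuantumFields.YangMills.Theorems.FlatCubeConstraintsFibre

open Literature.MathematicalPhysics.QuantumFieldTheory.Balaban1983to89
open B6SectADomainsV1 (Domains)
open T4ReflectionConeSharp (TwoBlockLocal twoBlockLocal_blockAvg)
open T3ContinuumYM3Torus (T3Family)
open T3TiltDescent (descendTo)
open T3ConstrainedMinimiser (fibre)
open T3DescentFibreTower (mem_fibre_iff)

variable {P : Params} {G : Type*} [GaugeGroup G]

/-! ## §1 The descent for two-block-local averagings, every nested family -/

/-- **THE MULTI-LEVEL CONSTRAINTS DETERMINE THE AVERAGES ON EVERY BOND WITH NO DEEP END-POINT**: if `U″` and `U` have the same `j`-fold averages on every index bond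
`(j, b) ∈ 𝔅` of `D` (bonds of `Λ_j`: an end-point in `Ω_j`, none inside `B(Ω_{j+1})`; level `0` = frozen exterior), then for every `m ≤ k` and every `m`-bond `c` whose
end-points are not inside `B(Ω_{m+1})`, `iter av m U″ c = iter av m U c` — by induction on `m`, through the two-block locality of each averaging step.
[cite: Balaban1985Variational, (150) p.301; Balaban1984PropagatorsII, (2.3)-(2.4) p.224] -/
theorem iter_eq_of_constraints (av : ∀ j, Averaging P j G) (hav : ∀ j, TwoBlockLocal (av j)) (D : Domains P) {U U'' : GaugeField P 0 G}
    (h : ∀ (j : ℕ) (b : PBond P j), D.LamBond j b → Averaging.iter av j U'' b = Averaging.iter av j U b) :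
    ∀ m : ℕ, m ≤ D.k → ∀ c : PBond P m, ¬ D.Deep m c.src → ¬ D.Deep m c.tgt → Averaging.iter av m U'' c = Averaging.iter av m U c := by
  intro m
  induction m with
  | zero =>
    intro _ c hs ht
    exact h 0 c ⟨Or.inl (by rw [D.Om_zero]; exact Finset.mem_univ _), hs, ht⟩
  | succ m ih =>
    intro hm c hs ht
    by_cases hc : c.src ∈ D.Om (m + 1) ∨ c.tgt ∈ D.Om (m + 1)
    · exact h (m + 1) c ⟨hc, hs, ht⟩
    · have hcs : c.src ∉ D.Om (m + 1) := fun h' => hc (Or.inl h')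
      have hct : c.tgt ∉ D.Om (m + 1) := fun h' => hc (Or.inr h')
      have hm' : m + 1 ≤ P.m + P.K := hm.trans D.hk
      show (av m).avg (Averaging.iter av m U'') c = (av m).avg (Averaging.iter av m U) c
      refine hav m hm' _ _ c fun b hbs hbt => ih (by omega) b ?_ ?_
      · intro hd
        rcases hbs with h1 | h1
        · exact hcs (by simpa [Domains.Deep, h1] using hd)
        · exact hct (by simpa [Domains.Deep, h1] using hd)
      · intro hd
        rcases hbt with h1 | h1
        · exact hcs (by simpa [Domains.Deep, h1] using hd)
        · exact hct (by simpa [Domains.Deep, h1] using hd)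

/-- **AT THE TOP LEVEL ALL BONDS AGREE**: `Averaging.iter av D.k U″ = Averaging.iter av D.k U` (no site is deep at level `k`: `Ω_{k+1} = ∅`) — print's «this space is defined by more
restrictive functional conditions» (150). [cite: Balaban1985Variational, (150) p.301] -/
theorem iter_top_eq_of_constraints (av : ∀ j, Averaging P j G) (hav : ∀ j, TwoBlockLocal (av j)) (D : Domains P) {U U'' : GaugeField P 0 G}
    (h : ∀ (j : ℕ) (b : PBond P j), D.LamBond j b → Averaging.iter av j U'' b = Averaging.iter av j U b) :
    Averaging.iter av D.k U'' = Averaging.iter av D.k U :=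
  funext fun c => iter_eq_of_constraints av hav D h D.k le_rfl c (D.not_deep_of_le le_rfl _) (D.not_deep_of_le le_rfl _)

/-! ## §2 At the d = 3 carrier with Bałaban's (0.4) averaging: the constrained set lies in the fibre -/

section T3

variable (F : T3Family) (ℰ : LoopAverage G)

/-- **THE (0.4)-DESCENT IS DETERMINED BY THE MULTI-LEVEL CONSTRAINTS**: for a nested family `D` on the fine torus of run `K` with top level `K − n`, agreement of the iterated (0.4)
averages on every index bond of `D` forces `descendTo F ℰ n K h U″ = descendTo F ℰ n K h U` (two-block locality of (0.4): `twoBlockLocal_blockAvg`).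
[cite: Balaban1985Variational, (150) p.301; Balaban1987RG1, (0.4) p.253] -/
theorem descendTo_eq_of_constraints (n K : ℕ) (h : n ≤ K) (D : Domains (F.P K)) (hD : D.k = K - n) {U U'' : GaugeField (F.P K) 0 G}
    (hc : ∀ (j : ℕ) (b : PBond (F.P K) j), D.LamBond j b →
      Averaging.iter (fun i => BlockAveraging.blockAvg (P := F.P K) (j := i) ℰ) j U'' b =
        Averaging.iter (fun i => BlockAveraging.blockAvg (P := F.P K) (j := i) ℰ) j U b) :
    descendTo F ℰ n K h U'' = descendTo F ℰ n K h U := by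
  have htop := iter_top_eq_of_constraints (fun i => BlockAveraging.blockAvg (P := F.P K) (j := i) ℰ) (fun i => twoBlockLocal_blockAvg ℰ) D hc
  rw [hD] at htop
  unfold descendTo
  rw [htop]

/-- **J0 «𝒞_D(U) ⊆ fibre(V)»**: if `U` lies in the fibre of `V` and `U″` satisfies the multi-level bond-indexed constraints of `D` with the data of `U`, then `U″` lies in the fibre of
`V`. [cite: Balaban1985Variational, (150) p.301, (156) p.302] -/
theorem constraints_sub_fibre (n K : ℕ) (h : n ≤ K) (D : Domains (F.P K)) (hD : D.k = K - n) {V : GaugeField (F.P n) 0 G} {U U'' : GaugeField (F.P K) 0 G}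
    (hU : U ∈ fibre F ℰ n K h V)
    (hc : ∀ (j : ℕ) (b : PBond (F.P K) j), D.LamBond j b →
      Averaging.iter (fun i => BlockAveraging.blockAvg (P := F.P K) (j := i) ℰ) j U'' b =
        Averaging.iter (fun i => BlockAveraging.blockAvg (P := F.P K) (j := i) ℰ) j U b) :
    U'' ∈ fibre F ℰ n K h V := by
  rw [mem_fibre_iff] at hU ⊢
  rw [descendTo_eq_of_constraints F ℰ n K h D hD hc, hU]

/-- **J0 FOR THE CUBE SEQUENCE (144)** (`D := FlatCubeSequence.cubeSeqT3 F n K x₀ ρ S`): the configurations with `U″ = U` off `□₁` and the same `j`-fold (0.4) averages on the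
annuli `Λ′_j` (`1 ≤ j ≤ K − n`) lie in the fibre of `V` whenever `U` does — P0's local problem (150) is a SUBSET of the global one. (The M-aligned `cubeSeqMT3` is the same
one-liner through `constraints_sub_fibre`.) [cite: Balaban1985Variational, (144) p.300, (150) p.301] -/
theorem constraints_cubeSeq_sub_fibre (n K : ℕ) (h : n ≤ K) (x₀ : Site (F.P K) 0) (ρ S : ℕ) {V : GaugeField (F.P n) 0 G} {U U'' : GaugeField (F.P K) 0 G}
    (hU : U ∈ fibre F ℰ n K h V)
    (hc : ∀ (j : ℕ) (b : PBond (F.P K) j), (FlatCubeSequence.cubeSeqT3 F n K x₀ ρ S).LamBond j b →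
      Averaging.iter (fun i => BlockAveraging.blockAvg (P := F.P K) (j := i) ℰ) j U'' b =
        Averaging.iter (fun i => BlockAveraging.blockAvg (P := F.P K) (j := i) ℰ) j U b) :
    U'' ∈ fibre F ℰ n K h V :=
  constraints_sub_fibre F ℰ n K h (FlatCubeSequence.cubeSeqT3 F n K x₀ ρ S) rfl hU hc

end T3

end Summit.QuantumFields.YangMills.Theorems.FlatCubeConstraintsFibre
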